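import Mathlib
import Summits.Ventures.PercRepro2.TwoCopyBHK
import Summits.Ventures.PercRepro2.RootEdgeThreeMark

/-!
# The typed (two-copy) form of (3M): its kernel is the cross-cluster BHK kernel times the
`v`-disagreement factor, and the complementary-pair counts `ThreeMarkCount` give (3M), hence
`RootCross` and the root-edge rows
(blind cell PercRepro2, night-3 g22, 2026-08-28; `proofs/NIGHT3-CERT.md` §31.4)

With `Q = {a₁ ↮ a₂}`, `bL = {b ∈ C(a₁)}`, `oH = {o ∈ C(a₂)}`, `vH = {v ∈ C(a₂)}` the (3M)-slack
`Λ(p) = m(101)m(010) + m(001)m(110) − m(011)m(100) − m(111)m(000)` of `RootEdgeCells.lean` is the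
bilinear form of the kernel

  `K₃ₘ(x, y) = crossKernel(a₁, a₂, b, o)(x, y) · (1_{vH}(x) − 1_{vH}(y))²`
            `= 1_Q(x) 1_Q(y) (1_{bL}(x) − 1_{bL}(y)) (1_{oH}(y) − 1_{oH}(x)) (1_{vH}(x) − 1_{vH}(y))²`

(`threeMarkKernel`; `biForm_threeMarkKernel`: `biForm q q' K₃ₘ = B(m_q, m_{q'}) + B(m_{q'}, m_q)` for
the bilinear form `B` of `Λ`, so `biForm p p K₃ₘ = 2 Λ(p)`): (3M) is p1's cross-cluster BHK slack
(`TwoCopyBHK.lean`, row (BASE)) restricted to the configuration pairs in which `v`'s membership in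
`C(a₂)` DIFFERS.  The closed form of the `(v, o)`-cell kernel is
`ρ(W, W′) = [v ∈ W ⊕ v ∈ W′]·([o ∈ W′] − [o ∈ W])` (`threeMarkKernel_eq`).

* **`ThreeMarkCount`** — the typed candidate (NOT claimed proved): every complementary-pair count
  `pinnedCount G z K₃ₘ` is nonnegative (the two-copy Bernstein coefficients of `Λ`; census night-3
  g22: 0 negative / 22,462 patterns with nonzero pairs, 18,608 nonzero, 300 random instances
  n ≤ 7, m ≤ 9, §31.4).  It is the `v`-disagreement part of `CrossCount` (row (BASE) / 2′TBHK):
  `crossKernel = K₃ₘ + crossKernel·(1 − (1_{vH}(x) − 1_{vH}(y))²)`, and the two candidates are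
  incomparable (the `v`-agreement part is not signed: §31.4).
* **`threeMark_of_threeMarkCount`**: `ThreeMarkCount → ThreeMark` by p1's reduction
  `disSum_nonneg_of_pinnedCount` at `F = ∅`; **`rootCross_of_threeMarkCount`** and the root-edge
  rows follow through `RootEdgeThreeMark.lean`.
* **`twoCopyThreeMark_of_threeMarkCount`**: the one-edge pinned cross term
  `X_f = B(m¹, m⁰) + B(m⁰, m¹) ≥ 0` for every edge `f` with `0 < p_f < 1` (the singleton
  disagreement sum; at a root edge `X_g = RootCross`, §31.2; census 0 / 10,899 edge-instances).

Own work; standard axioms.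
-/

namespace Summit.Ventures.PercRepro2

open UnionCluster

namespace CovForm

namespace RootEdge

variable {V : Type*} {E : Type*} [Fintype E] [DecidableEq E] [DecidableEq V]
  {R : Type*} [Field R] [LinearOrder R] [IsStrictOrderedRing R]

/-! ## The kernel -/

/-- **The (3M) kernel**: the cross-cluster BHK kernel `crossKernel(a₁, a₂, b, o)` of
`TwoCopyBHK.lean` times the `v`-disagreement factor `(1_{vH}(x) − 1_{vH}(y))²`. -/
noncomputable def threeMarkKernel (ends : E → Sym2 V) (a₁ a₂ b o v : V) (x y : Config E) : R :=
  crossKernel ends a₁ a₂ b o x y *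
    ((connEvent ends a₂ v).indicator 1 x - (connEvent ends a₂ v).indicator 1 y) ^ 2

omit [Fintype E] [DecidableEq E] [DecidableEq V] [LinearOrder R] [IsStrictOrderedRing R] in
/-- `Q = {a₁ ↮ a₂}` as the complement of the connection event (the two spellings of `Q`). -/
lemma avoidAll_singleton_eq_compl (ends : E → Sym2 V) (a₁ a₂ : V) :
    avoidAll ends a₂ {a₁} = (connEvent ends a₁ a₂)ᶜ := by
  ext ω
  simp only [mem_avoidAll, Finset.mem_singleton, forall_eq, Set.mem_compl_iff, mem_connEvent]
  exact ⟨fun h hc => h (conn_symm hc), fun h hc => h (conn_symm hc)⟩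

omit [Fintype E] [DecidableEq E] [DecidableEq V] [LinearOrder R] [IsStrictOrderedRing R] in
/-- A `0/1` indicator is idempotent. -/
lemma indicator_one_mul_self (A : Set (Config E)) (x : Config E) :
    A.indicator (1 : Config E → R) x * A.indicator 1 x = A.indicator 1 x := by
  by_cases h : x ∈ A <;> simp [h]

omit [Fintype E] [DecidableEq E] [DecidableEq V] [LinearOrder R] [IsStrictOrderedRing R] in
/-- The indicator of a cell `Q ∩ {[v ∈ C₂] = χ, [o ∈ C₂] = ω, [b ∈ C₁] = β}` as a product of the
four indicators. -/
lemma indicator_Q_cellSet (ends : E → Sym2 V) (a₁ a₂ b o v : V) (χ ω β : Bool) (x : Config E) :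
    (avoidAll ends a₂ {a₁} ∩ cellSet ends a₁ a₂ b o v χ ω β).indicator (1 : Config E → R) x =
      (avoidAll ends a₂ {a₁}).indicator 1 x *
        (if χ then (connEvent ends a₂ v).indicator 1 x
          else 1 - (connEvent ends a₂ v).indicator 1 x) *
        (if ω then (connEvent ends a₂ o).indicator 1 x
          else 1 - (connEvent ends a₂ o).indicator 1 x) *
        (if β then (connEvent ends a₁ b).indicator 1 x
          else 1 - (connEvent ends a₁ b).indicator 1 x) := by
  by_cases hQ : x ∈ avoidAll ends a₂ {a₁} <;> by_cases hv : Conn ends x a₂ v <;>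
    by_cases ho : Conn ends x a₂ o <;> by_cases hb : Conn ends x a₁ b <;>
    cases χ <;> cases ω <;> cases β <;>
    simp [cellSet, connEvent, hQ, hv, ho, hb]

omit [Fintype E] [DecidableEq E] [DecidableEq V] [LinearOrder R] [IsStrictOrderedRing R] in
/-- The (3M) kernel in cell form: with `I_{χωβ} = 1_{Q ∩ cell(χ, ω, β)}` and
`T(x, y) = I₁₀₁(x)I₀₁₀(y) + I₀₀₁(x)I₁₁₀(y) − I₀₁₁(x)I₁₀₀(y) − I₁₁₁(x)I₀₀₀(y)`,
`K₃ₘ(x, y) = T(x, y) + T(y, x)` — the symmetrisation of «`b ∈ C₁` in `x` only, `v`'s side differs,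
and `o ∈ C₂` in `y` rather than in `x`». -/
theorem threeMarkKernel_eq (ends : E → Sym2 V) (a₁ a₂ b o v : V) (x y : Config E) :
    threeMarkKernel (R := R) ends a₁ a₂ b o v x y =
      ((avoidAll ends a₂ {a₁} ∩ cellSet ends a₁ a₂ b o v true false true).indicator 1 x *
            (avoidAll ends a₂ {a₁} ∩ cellSet ends a₁ a₂ b o v false true false).indicator 1 y +
          (avoidAll ends a₂ {a₁} ∩ cellSet ends a₁ a₂ b o v false false true).indicator 1 x *
            (avoidAll ends a₂ {a₁} ∩ cellSet ends a₁ a₂ b o v true true false).indicator 1 y -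
          (avoidAll ends a₂ {a₁} ∩ cellSet ends a₁ a₂ b o v false true true).indicator 1 x *
            (avoidAll ends a₂ {a₁} ∩ cellSet ends a₁ a₂ b o v true false false).indicator 1 y -
          (avoidAll ends a₂ {a₁} ∩ cellSet ends a₁ a₂ b o v true true true).indicator 1 x *
            (avoidAll ends a₂ {a₁} ∩ cellSet ends a₁ a₂ b o v false false false).indicator 1 y) +
        ((avoidAll ends a₂ {a₁} ∩ cellSet ends a₁ a₂ b o v true false true).indicator 1 y *
            (avoidAll ends a₂ {a₁} ∩ cellSet ends a₁ a₂ b o v false true false).indicator 1 x +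
          (avoidAll ends a₂ {a₁} ∩ cellSet ends a₁ a₂ b o v false false true).indicator 1 y *
            (avoidAll ends a₂ {a₁} ∩ cellSet ends a₁ a₂ b o v true true false).indicator 1 x -
          (avoidAll ends a₂ {a₁} ∩ cellSet ends a₁ a₂ b o v false true true).indicator 1 y *
            (avoidAll ends a₂ {a₁} ∩ cellSet ends a₁ a₂ b o v true false false).indicator 1 x -
          (avoidAll ends a₂ {a₁} ∩ cellSet ends a₁ a₂ b o v true true true).indicator 1 y *
            (avoidAll ends a₂ {a₁} ∩ cellSet ends a₁ a₂ b o v false false false).indicator 1 x) := by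
  simp only [indicator_Q_cellSet, threeMarkKernel, crossKernel, ← avoidAll_singleton_eq_compl,
    Bool.false_eq_true, ↓reduceIte]
  -- a polynomial identity modulo the idempotency of the two `v`-indicators
  have hx := indicator_one_mul_self (R := R) (connEvent ends a₂ v) x
  have hy := indicator_one_mul_self (R := R) (connEvent ends a₂ v) y
  linear_combination
    ((avoidAll ends a₂ {a₁}).indicator 1 x * (avoidAll ends a₂ {a₁}).indicator 1 y *
      ((connEvent ends a₁ b).indicator 1 x - (connEvent ends a₁ b).indicator 1 y) *
      ((connEvent ends a₂ o).indicator 1 y - (connEvent ends a₂ o).indicator 1 x)) * hx +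
    ((avoidAll ends a₂ {a₁}).indicator 1 x * (avoidAll ends a₂ {a₁}).indicator 1 y *
      ((connEvent ends a₁ b).indicator 1 x - (connEvent ends a₁ b).indicator 1 y) *
      ((connEvent ends a₂ o).indicator 1 y - (connEvent ends a₂ o).indicator 1 x)) * hy

/-! ## The bilinear form of the kernel is the (3M) slack -/

omit [DecidableEq V] [LinearOrder R] [IsStrictOrderedRing R] in
/-- **The bilinear form of the (3M) kernel**: with `B(m, m′) = m(101)m′(010) + m(001)m′(110) −
m(011)m′(100) − m(111)m′(000)` the bilinear form of `Λ`, `biForm q q′ K₃ₘ = B(m_q, m_{q′}) +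
B(m_{q′}, m_q)`. -/
theorem biForm_threeMarkKernel (q q' : E → R) (ends : E → Sym2 V) (a₁ a₂ b o v : V) :
    biForm q q' (threeMarkKernel ends a₁ a₂ b o v) =
      (cell q ends a₁ a₂ b o v true false true * cell q' ends a₁ a₂ b o v false true false +
          cell q ends a₁ a₂ b o v false false true * cell q' ends a₁ a₂ b o v true true false -
          cell q ends a₁ a₂ b o v false true true * cell q' ends a₁ a₂ b o v true false false -
          cell q ends a₁ a₂ b o v true true true * cell q' ends a₁ a₂ b o v false false false) +
        (cell q' ends a₁ a₂ b o v true false true * cell q ends a₁ a₂ b o v false true false +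
          cell q' ends a₁ a₂ b o v false false true * cell q ends a₁ a₂ b o v true true false -
          cell q' ends a₁ a₂ b o v false true true * cell q ends a₁ a₂ b o v true false false -
          cell q' ends a₁ a₂ b o v true true true * cell q ends a₁ a₂ b o v false false false) := by
  -- the second bracket is the first with the summation order exchanged
  have swap : ∀ (A B : Set (Config E)),
      prob q' A * prob q B = ∑ x : Config E, ∑ y : Config E,
        weight q x * weight q' y * (A.indicator 1 y * B.indicator 1 x) := by
    intro A B
    simp only [prob_eq_expect_indicator, expect, Finset.sum_mul_sum]
    rw [Finset.sum_comm]
    refine Finset.sum_congr rfl fun x _ => Finset.sum_congr rfl fun y _ => ?_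
    ring
  have direct : ∀ (A B : Set (Config E)),
      prob q A * prob q' B = ∑ x : Config E, ∑ y : Config E,
        weight q x * weight q' y * (A.indicator 1 x * B.indicator 1 y) := by
    intro A B
    simp only [prob_eq_expect_indicator, expect, Finset.sum_mul_sum]
    refine Finset.sum_congr rfl fun x _ => Finset.sum_congr rfl fun y _ => ?_
    ring
  simp only [cell, direct, swap, biForm]
  simp only [← Finset.sum_add_distrib, ← Finset.sum_sub_distrib]
  refine Finset.sum_congr rfl fun x _ => Finset.sum_congr rfl fun y _ => ?_
  rw [threeMarkKernel_eq]
  ring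

/-! ## The typed candidate and its consequences -/

/-- **`ThreeMarkCount`, the typed (3M) candidate (NOT claimed proved)**: for every minor `(G, z)`
the complementary-pair count of the (3M) kernel is nonnegative — the two-copy Bernstein
coefficients of the (3M) slack are all `≥ 0` (night-3 g22 census: 0 negative / 22,462 patterns
with nonzero pairs, 300 random instances, §31.4).  It is the `v`-disagreement part of `CrossCount`
(row (BASE)). -/
def ThreeMarkCount (R : Type*) [Field R] [LinearOrder R] [IsStrictOrderedRing R]
    (ends : E → Sym2 V) (a₁ a₂ b o v : V) : Prop :=
  ∀ (G : Finset E) (z : Config E), 0 ≤ pinnedCount G z (threeMarkKernel (R := R) ends a₁ a₂ b o v)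

omit [DecidableEq V] in
/-- **(3M) from its typed form**: `ThreeMarkCount → ThreeMark` (p1's reduction
`disSum_nonneg_of_pinnedCount` at `F = ∅`, with `biForm p p K₃ₘ = 2 Λ(p)`). -/
theorem threeMark_of_threeMarkCount {ends : E → Sym2 V} {a₁ a₂ b o v : V}
    (hC : ThreeMarkCount R ends a₁ a₂ b o v) : ThreeMark (R := R) ends a₁ a₂ b o v := by
  intro p hp
  have hd := disSum_nonneg_of_pinnedCount (threeMarkKernel (R := R) ends a₁ a₂ b o v) hC p
    (fun e => ⟨hp.nonneg e, hp.le_one e⟩) ∅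
  rw [disSum_empty, biForm_threeMarkKernel] at hd
  linarith [hd]

omit [DecidableEq V] in
/-- **`RootCross` from the typed (3M)**: `ThreeMarkCount → RootCross` on every graph with an edge
`g = {a₁, v}` (through `rootCross_of_threeMark`). -/
theorem rootCross_of_threeMarkCount (ends : E → Sym2 V) (o a₁ a₂ b v : V) {g : E}
    (hg : ends g = s(a₁, v)) (hC : ThreeMarkCount R ends a₁ a₂ b o v) :
    RootCross (R := R) ends a₁ a₂ b o v :=
  rootCross_of_threeMark ends o a₁ a₂ b v hg (threeMark_of_threeMarkCount hC)

omit [DecidableEq V] in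
/-- **The one-edge pinned cross term of (3M) from the typed form**: for every edge `f` with
`0 < p_f < 1`, `X_f = B(m¹, m⁰) + B(m⁰, m¹) ≥ 0` with `m^s` the cells of `p[f := s]` — the
singleton disagreement sum of `K₃ₘ` (night-3 g22 census: 0 / 10,899 edge-instances; at a root edge
`X_g` is the `RootCross` slack, §31.2). -/
theorem twoCopyThreeMark_of_threeMarkCount {ends : E → Sym2 V} {a₁ a₂ b o v : V}
    (hC : ThreeMarkCount R ends a₁ a₂ b o v) (p : E → R) (hp : IsProbVec p) (f : E)
    (hf0 : 0 < p f) (hf1 : p f < 1) :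
    0 ≤ (cell (Function.update p f 1) ends a₁ a₂ b o v true false true *
            cell (Function.update p f 0) ends a₁ a₂ b o v false true false +
          cell (Function.update p f 1) ends a₁ a₂ b o v false false true *
            cell (Function.update p f 0) ends a₁ a₂ b o v true true false -
          cell (Function.update p f 1) ends a₁ a₂ b o v false true true *
            cell (Function.update p f 0) ends a₁ a₂ b o v true false false -
          cell (Function.update p f 1) ends a₁ a₂ b o v true true true *
            cell (Function.update p f 0) ends a₁ a₂ b o v false false false) +
        (cell (Function.update p f 0) ends a₁ a₂ b o v true false true *
            cell (Function.update p f 1) ends a₁ a₂ b o v false true false +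
          cell (Function.update p f 0) ends a₁ a₂ b o v false false true *
            cell (Function.update p f 1) ends a₁ a₂ b o v true true false -
          cell (Function.update p f 0) ends a₁ a₂ b o v false true true *
            cell (Function.update p f 1) ends a₁ a₂ b o v true false false -
          cell (Function.update p f 0) ends a₁ a₂ b o v true true true *
            cell (Function.update p f 1) ends a₁ a₂ b o v false false false) := by
  have hd := disSum_nonneg_of_pinnedCount (threeMarkKernel (R := R) ends a₁ a₂ b o v) hC p
    (fun e => ⟨hp.nonneg e, hp.le_one e⟩) {f}
  rw [disSum_singleton, biForm_threeMarkKernel, biForm_threeMarkKernel] at hd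
  have hpos : 0 < p f * (1 - p f) := mul_pos hf0 (sub_pos.mpr hf1)
  have h2 := nonneg_of_mul_nonneg_right hd hpos
  linarith [h2]

/-! ## The split of the cross-cluster BHK kernel by `v`-agreement -/

omit [Fintype E] [DecidableEq E] [DecidableEq V] [LinearOrder R] [IsStrictOrderedRing R] in
/-- `crossKernel = K₃ₘ + crossKernel·(1 − (1_{vH}(x) − 1_{vH}(y))²)`: row (BASE)'s kernel is the
(3M) kernel plus its `v`-agreement part. -/
lemma crossKernel_eq_threeMarkKernel_add (ends : E → Sym2 V) (a₁ a₂ b o v : V)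
    (x y : Config E) :
    crossKernel (R := R) ends a₁ a₂ b o x y =
      threeMarkKernel ends a₁ a₂ b o v x y +
        crossKernel ends a₁ a₂ b o x y *
          (1 - ((connEvent ends a₂ v).indicator 1 x - (connEvent ends a₂ v).indicator 1 y) ^ 2) := by
  unfold threeMarkKernel
  ring

omit [DecidableEq V] [LinearOrder R] [IsStrictOrderedRing R] in
/-- The complementary-pair counts split accordingly:
`pinnedCount G z crossKernel = pinnedCount G z K₃ₘ + pinnedCount G z (v-agreement part)`. -/
lemma pinnedCount_crossKernel_split (ends : E → Sym2 V) (a₁ a₂ b o v : V) (G : Finset E)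
    (z : Config E) :
    pinnedCount G z (crossKernel (R := R) ends a₁ a₂ b o) =
      pinnedCount G z (threeMarkKernel ends a₁ a₂ b o v) +
        pinnedCount G z (fun x y => crossKernel ends a₁ a₂ b o x y *
          (1 - ((connEvent ends a₂ v).indicator 1 x - (connEvent ends a₂ v).indicator 1 y) ^ 2)) := by
  unfold pinnedCount
  rw [← Finset.sum_add_distrib]
  refine Finset.sum_congr rfl fun x _ => ?_
  split_ifs
  · exact crossKernel_eq_threeMarkKernel_add ends a₁ a₂ b o v x _
  · simp

end RootEdge

end CovForm

end Summit.Ventures.PercRepro2
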